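import Mathlib
import Summits.Ventures.PercRepro2.RowC1E1Avoid

/-!
# The `b`-avoiding row (c1′) of row 2′C1, the chain (E1′) ⟹ (c1′) ⟹ (c1), and the complement form
of the row (blind cell PercRepro2, p2 g30; proofs/P2-G30-C1.md §1–§2)

With `Q = {a₁ ↮ a₂}`, `C₁ = C(a₁)`, `C₂ = C(a₂)`, `U = C₁ ∪ C₂`, `μ = P(· | Q)` and
`o ∈ U′` = «`o` is joined to a root by an open path avoiding the vertex `b`» (`avoidConnEvent`),
row 2′C1 reads `μ(b ∈ C₂)·μ(o ∈ U) ≤ μ(b ∈ U, o ∈ U)` and its `b`-avoiding form is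

  **(c1′)**  `μ(b ∈ C₂)·μ(o ∈ U′) ≤ μ(b ∈ U, o ∈ U′)`,

cleared by `P(Q)²` (`C1Avoid`).  This file proves
* **`c1avoid_of_e1avoid`**: `E1Avoid ⟹ C1Avoid` — (c1′) is the `b`-avoiding row with the
  compensation `μ(b ∈ C₁, o ∈ U′)` in place of the `μ(b ∈ C₁, o ∈ K₁)` of (E1′), so it is the
  weaker statement (additivity on `Q`);
* **`c1_of_c1avoid`**: `C1Avoid ⟹` row 2′C1 — the cut lemma `conn_of_not_avoidConn`: on `Q`, the
  «via `b`» part `{o ∈ U} ∖ {o ∈ U′}` lies inside `{b ∈ U}`;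
* **`c1_iff_compl`**: the row is EQUIVALENT to its complement form
  `μ(b ∉ U, o ∈ U) ≤ μ(b ∉ C₂)·μ(o ∈ U)`, i.e. `Cov_μ(1[b ∉ U], 1[o ∈ U]) ≤ μ(b ∈ C₁)·μ(o ∈ U)`
  (cleared: `P(Q)·P(Q, b ∉ U, o ∈ U) ≤ P(Q, b ∉ C₂)·P(Q, o ∈ U)`), and likewise
  **`c1avoid_iff_compl`** for (c1′) with `U′`.
So the chain of the lane is (E1′) ⟹ (c1′) ⟹ (c1) next to (E1′) ⟹ (E1) ⟹ (c1).  (c1′) is a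
CONJECTURE of the cell (exact census 0 / 1,500 at n ≤ 6, log-odds descents 0 / 4,497; proofs/P2-G30-C1.md),
not a fact.
-/

namespace Summit.Ventures.PercRepro2

namespace RowC1

section AvoidRow

variable {V : Type*} {E : Type*} [Fintype E] [DecidableEq E]
  {R : Type*} [CommRing R] [LinearOrder R] [IsStrictOrderedRing R]

/-- **(c1′)**, the `b`-avoiding row, cleared by `P(Q)²`:
`P(Q, b ∈ C₂) · P(Q, o ∈ U′) ≤ P(Q) · P(Q, o ∈ U′, b ∈ U)`, where `o ∈ U′` = `o` joined to `a₁`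
or `a₂` avoiding `b`.  A CONJECTURE (p2 g30); it lies between (E1′) and row 2′C1. -/
def C1Avoid (p : E → R) (ends : E → Sym2 V) (a₁ a₂ o b : V) : Prop :=
  prob p (connEvent ends a₂ b ∩ (connEvent ends a₁ a₂)ᶜ) *
      prob p ((avoidConnEvent ends b a₁ o ∪ avoidConnEvent ends b a₂ o) ∩
        (connEvent ends a₁ a₂)ᶜ) ≤
    prob p (connEvent ends a₁ a₂)ᶜ *
      prob p ((avoidConnEvent ends b a₁ o ∪ avoidConnEvent ends b a₂ o) ∩
        (connEvent ends a₁ b ∪ connEvent ends a₂ b) ∩ (connEvent ends a₁ a₂)ᶜ)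

/-- The two compensations of (E1′), `{b ∈ C₂, o ∈ U′, Q}` and `{b ∈ C₁, o ∈ K₁, Q}`, are disjoint
and both lie in `{o ∈ U′, b ∈ U, Q}`. -/
lemma e1avoid_pieces_le (p : E → R) (hp : IsProbVec p) (ends : E → Sym2 V) (a₁ a₂ o b : V) :
    prob p (connEvent ends a₂ b ∩ (avoidConnEvent ends b a₁ o ∪ avoidConnEvent ends b a₂ o) ∩
        (connEvent ends a₁ a₂)ᶜ) +
      prob p (connEvent ends a₁ b ∩ avoidConnEvent ends b a₁ o ∩ (connEvent ends a₁ a₂)ᶜ) ≤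
    prob p ((avoidConnEvent ends b a₁ o ∪ avoidConnEvent ends b a₂ o) ∩
      (connEvent ends a₁ b ∪ connEvent ends a₂ b) ∩ (connEvent ends a₁ a₂)ᶜ) := by
  have hdisj : Disjoint (connEvent ends a₂ b ∩
      (avoidConnEvent ends b a₁ o ∪ avoidConnEvent ends b a₂ o) ∩ (connEvent ends a₁ a₂)ᶜ)
      (connEvent ends a₁ b ∩ avoidConnEvent ends b a₁ o ∩ (connEvent ends a₁ a₂)ᶜ) := by
    rw [Set.disjoint_left]
    rintro ω ⟨⟨hb2, -⟩, hQ⟩ ⟨⟨hb1, -⟩, -⟩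
    exact hQ (conn_trans hb1 (conn_symm hb2))
  rw [← prob_union_of_disjoint p hdisj]
  refine prob_mono hp ?_
  rintro ω (⟨⟨hb, ho⟩, hQ⟩ | ⟨⟨hb, ho⟩, hQ⟩)
  · exact ⟨⟨ho, Or.inr hb⟩, hQ⟩
  · exact ⟨⟨Or.inl ho, Or.inl hb⟩, hQ⟩

/-- **(c1′) from (E1′)**: `E1Avoid` gives `C1Avoid`. -/
theorem c1avoid_of_e1avoid (p : E → R) (hp : IsProbVec p) (ends : E → Sym2 V) (a₁ a₂ o b : V)
    (h : E1Avoid p ends a₁ a₂ o b) : C1Avoid p ends a₁ a₂ o b := by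
  unfold E1Avoid at h
  unfold C1Avoid
  exact h.trans (mul_le_mul_of_nonneg_left (e1avoid_pieces_le p hp ends a₁ a₂ o b)
    (prob_nonneg hp (connEvent ends a₁ a₂)ᶜ))

omit [Fintype E] [DecidableEq E] in
/-- The «via `b`» part of `{o ∈ U}`: if `o ∈ U` but `o ∉ U′`, then `b ∈ U` (the open path from `o`
to the root passes through `b`). -/
lemma mem_bU_of_via_b {ends : E → Sym2 V} {a₁ a₂ o b : V} {ω : Config E}
    (hoU : ω ∈ connEvent ends a₁ o ∪ connEvent ends a₂ o)
    (hnot : ω ∉ avoidConnEvent ends b a₁ o ∪ avoidConnEvent ends b a₂ o) :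
    ω ∈ connEvent ends a₁ b ∪ connEvent ends a₂ b := by
  rcases hoU with ho1 | ho2
  · have hn1 : ¬ Conn ends (delConfig ends {b} ω) a₁ o := fun h => hnot (Or.inl h)
    exact Or.inl (conn_symm (conn_of_not_avoidConn (conn_symm ho1) (fun h => hn1 (conn_symm h))))
  · have hn2 : ¬ Conn ends (delConfig ends {b} ω) a₂ o := fun h => hnot (Or.inr h)
    exact Or.inr (conn_symm (conn_of_not_avoidConn (conn_symm ho2) (fun h => hn2 (conn_symm h))))

/-- **Row 2′C1 from (c1′)**: `C1Avoid` gives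
`P(Q, b ∈ C₂)·P(Q, o ∈ U) ≤ P(Q)·P(Q, o ∈ U, b ∈ U)`. -/
theorem c1_of_c1avoid (p : E → R) (hp : IsProbVec p) (ends : E → Sym2 V) (a₁ a₂ o b : V)
    (h : C1Avoid p ends a₁ a₂ o b) :
    prob p (connEvent ends a₂ b ∩ (connEvent ends a₁ a₂)ᶜ) *
      prob p ((connEvent ends a₁ o ∪ connEvent ends a₂ o) ∩ (connEvent ends a₁ a₂)ᶜ) ≤
    prob p (connEvent ends a₁ a₂)ᶜ *
      prob p ((connEvent ends a₁ o ∪ connEvent ends a₂ o) ∩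
        (connEvent ends a₁ b ∪ connEvent ends a₂ b) ∩ (connEvent ends a₁ a₂)ᶜ) := by
  unfold C1Avoid at h
  set Q := (connEvent ends a₁ a₂)ᶜ with hQdef
  set BH := connEvent ends a₂ b with hBH
  set BU := connEvent ends a₁ b ∪ connEvent ends a₂ b with hBU
  set OU := connEvent ends a₁ o ∪ connEvent ends a₂ o with hOU
  set OU' := avoidConnEvent ends b a₁ o ∪ avoidConnEvent ends b a₂ o with hOU'
  have hsub : OU' ⊆ OU := by
    rintro ω (h1 | h2)
    · exact Or.inl (conn_of_avoidConn h1)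
    · exact Or.inr (conn_of_avoidConn h2)
  -- `{o ∈ U} ∩ Q = ({o ∈ U′} ∩ Q) ⊔ ({o ∈ U} ∖ {o ∈ U′}) ∩ Q`
  have e1 : prob p (OU ∩ Q) = prob p (OU' ∩ Q) + prob p (OU ∩ OU'ᶜ ∩ Q) := by
    rw [← prob_union_of_disjoint p]
    · congr 1
      ext ω
      simp only [Set.mem_inter_iff, Set.mem_union, Set.mem_compl_iff]
      constructor
      · rintro ⟨hu, hq⟩
        by_cases hu' : ω ∈ OU'
        · exact Or.inl ⟨hu', hq⟩
        · exact Or.inr ⟨⟨hu, hu'⟩, hq⟩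
      · rintro (⟨hu', hq⟩ | ⟨⟨hu, -⟩, hq⟩)
        · exact ⟨hsub hu', hq⟩
        · exact ⟨hu, hq⟩
    · rw [Set.disjoint_left]
      rintro ω ⟨hu', -⟩ ⟨⟨-, hn⟩, -⟩
      exact hn hu'
  -- the same split of `{o ∈ U} ∩ {b ∈ U} ∩ Q`
  have e2 : prob p (OU ∩ BU ∩ Q) = prob p (OU' ∩ BU ∩ Q) + prob p (OU ∩ OU'ᶜ ∩ BU ∩ Q) := by
    rw [← prob_union_of_disjoint p]
    · congr 1
      ext ω
      simp only [Set.mem_inter_iff, Set.mem_union, Set.mem_compl_iff]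
      constructor
      · rintro ⟨⟨hu, hb⟩, hq⟩
        by_cases hu' : ω ∈ OU'
        · exact Or.inl ⟨⟨hu', hb⟩, hq⟩
        · exact Or.inr ⟨⟨⟨hu, hu'⟩, hb⟩, hq⟩
      · rintro (⟨⟨hu', hb⟩, hq⟩ | ⟨⟨⟨hu, -⟩, hb⟩, hq⟩)
        · exact ⟨⟨hsub hu', hb⟩, hq⟩
        · exact ⟨⟨hu, hb⟩, hq⟩
    · rw [Set.disjoint_left]
      rintro ω ⟨⟨hu', -⟩, -⟩ ⟨⟨⟨-, hn⟩, -⟩, -⟩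
      exact hn hu'
  -- on the «via `b`» part, `b ∈ U` holds (cut lemma)
  have e3 : prob p (OU ∩ OU'ᶜ ∩ BU ∩ Q) = prob p (OU ∩ OU'ᶜ ∩ Q) := by
    congr 1
    ext ω
    simp only [Set.mem_inter_iff, Set.mem_compl_iff]
    constructor
    · rintro ⟨⟨⟨hu, hn⟩, -⟩, hq⟩
      exact ⟨⟨hu, hn⟩, hq⟩
    · rintro ⟨⟨hu, hn⟩, hq⟩
      exact ⟨⟨⟨hu, hn⟩, mem_bU_of_via_b hu hn⟩, hq⟩
  have hxu : prob p (BH ∩ Q) ≤ prob p Q := prob_mono hp Set.inter_subset_right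
  have h0v : 0 ≤ prob p (OU ∩ OU'ᶜ ∩ Q) := prob_nonneg hp _
  rw [e1, e2, e3]
  nlinarith [h, hxu, h0v, mul_le_mul_of_nonneg_right hxu h0v]

/-- **The complement form of row 2′C1.**  The row
`P(Q, b ∈ C₂)·P(Q, o ∈ U) ≤ P(Q)·P(Q, o ∈ U, b ∈ U)` is equivalent to
`P(Q)·P(Q, o ∈ U, b ∉ U) ≤ P(Q, b ∉ C₂)·P(Q, o ∈ U)`, i.e. to
`μ(b ∉ U, o ∈ U) ≤ μ(b ∉ C₂)·μ(o ∈ U)` (`Cov_μ(1[b ∉ U], 1[o ∈ U]) ≤ μ(b ∈ C₁)·μ(o ∈ U)`):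
the two differences coincide by additivity on `Q`. -/
theorem c1_iff_compl (p : E → R) (ends : E → Sym2 V) (a₁ a₂ o b : V) :
    (prob p (connEvent ends a₂ b ∩ (connEvent ends a₁ a₂)ᶜ) *
        prob p ((connEvent ends a₁ o ∪ connEvent ends a₂ o) ∩ (connEvent ends a₁ a₂)ᶜ) ≤
      prob p (connEvent ends a₁ a₂)ᶜ *
        prob p ((connEvent ends a₁ o ∪ connEvent ends a₂ o) ∩
          (connEvent ends a₁ b ∪ connEvent ends a₂ b) ∩ (connEvent ends a₁ a₂)ᶜ)) ↔
    (prob p (connEvent ends a₁ a₂)ᶜ *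
        prob p ((connEvent ends a₁ o ∪ connEvent ends a₂ o) ∩
          (connEvent ends a₁ b ∪ connEvent ends a₂ b)ᶜ ∩ (connEvent ends a₁ a₂)ᶜ) ≤
      prob p ((connEvent ends a₂ b)ᶜ ∩ (connEvent ends a₁ a₂)ᶜ) *
        prob p ((connEvent ends a₁ o ∪ connEvent ends a₂ o) ∩ (connEvent ends a₁ a₂)ᶜ)) := by
  set Q := (connEvent ends a₁ a₂)ᶜ with hQdef
  set BH := connEvent ends a₂ b with hBH
  set BU := connEvent ends a₁ b ∪ connEvent ends a₂ b with hBU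
  set OU := connEvent ends a₁ o ∪ connEvent ends a₂ o with hOU
  -- `P(Q) = P(Q, b ∈ C₂) + P(Q, b ∉ C₂)`
  have e1 : prob p (BH ∩ Q) + prob p (BHᶜ ∩ Q) = prob p Q := by
    have := prob_inter_add_prob_inter_compl p Q BH
    rwa [Set.inter_comm Q BH, Set.inter_comm Q BHᶜ] at this
  -- `P(Q, o ∈ U) = P(Q, o ∈ U, b ∈ U) + P(Q, o ∈ U, b ∉ U)`
  have e2 : prob p (OU ∩ BU ∩ Q) + prob p (OU ∩ BUᶜ ∩ Q) = prob p (OU ∩ Q) := by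
    have := prob_inter_add_prob_inter_compl p (OU ∩ Q) BU
    have h1 : OU ∩ Q ∩ BU = OU ∩ BU ∩ Q := by ext ω; simp only [Set.mem_inter_iff]; tauto
    have h2 : OU ∩ Q ∩ BUᶜ = OU ∩ BUᶜ ∩ Q := by ext ω; simp only [Set.mem_inter_iff]; tauto
    rwa [h1, h2] at this
  have e1' : prob p (BHᶜ ∩ Q) = prob p Q - prob p (BH ∩ Q) := by linarith
  have e2' : prob p (OU ∩ BUᶜ ∩ Q) = prob p (OU ∩ Q) - prob p (OU ∩ BU ∩ Q) := by linarith
  have key : prob p (BHᶜ ∩ Q) * prob p (OU ∩ Q) - prob p Q * prob p (OU ∩ BUᶜ ∩ Q) =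
      prob p Q * prob p (OU ∩ BU ∩ Q) - prob p (BH ∩ Q) * prob p (OU ∩ Q) := by
    rw [e1', e2']; ring
  constructor
  · intro h
    linarith [key]
  · intro h
    linarith [key]

/-- **The complement form of (c1′)**: `C1Avoid` is equivalent to
`P(Q)·P(Q, o ∈ U′, b ∉ U) ≤ P(Q, b ∉ C₂)·P(Q, o ∈ U′)`, i.e. `μ(b ∉ U, o ∈ U′) ≤ μ(b ∉ C₂)·μ(o ∈ U′)`. -/
theorem c1avoid_iff_compl (p : E → R) (ends : E → Sym2 V) (a₁ a₂ o b : V) :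
    C1Avoid p ends a₁ a₂ o b ↔
    (prob p (connEvent ends a₁ a₂)ᶜ *
        prob p ((avoidConnEvent ends b a₁ o ∪ avoidConnEvent ends b a₂ o) ∩
          (connEvent ends a₁ b ∪ connEvent ends a₂ b)ᶜ ∩ (connEvent ends a₁ a₂)ᶜ) ≤
      prob p ((connEvent ends a₂ b)ᶜ ∩ (connEvent ends a₁ a₂)ᶜ) *
        prob p ((avoidConnEvent ends b a₁ o ∪ avoidConnEvent ends b a₂ o) ∩
          (connEvent ends a₁ a₂)ᶜ)) := by
  unfold C1Avoid
  set Q := (connEvent ends a₁ a₂)ᶜ with hQdef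
  set BH := connEvent ends a₂ b with hBH
  set BU := connEvent ends a₁ b ∪ connEvent ends a₂ b with hBU
  set OU' := avoidConnEvent ends b a₁ o ∪ avoidConnEvent ends b a₂ o with hOU'
  have e1 : prob p (BH ∩ Q) + prob p (BHᶜ ∩ Q) = prob p Q := by
    have := prob_inter_add_prob_inter_compl p Q BH
    rwa [Set.inter_comm Q BH, Set.inter_comm Q BHᶜ] at this
  have e2 : prob p (OU' ∩ BU ∩ Q) + prob p (OU' ∩ BUᶜ ∩ Q) = prob p (OU' ∩ Q) := by
    have := prob_inter_add_prob_inter_compl p (OU' ∩ Q) BU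
    have h1 : OU' ∩ Q ∩ BU = OU' ∩ BU ∩ Q := by ext ω; simp only [Set.mem_inter_iff]; tauto
    have h2 : OU' ∩ Q ∩ BUᶜ = OU' ∩ BUᶜ ∩ Q := by ext ω; simp only [Set.mem_inter_iff]; tauto
    rwa [h1, h2] at this
  have e1' : prob p (BHᶜ ∩ Q) = prob p Q - prob p (BH ∩ Q) := by linarith
  have e2' : prob p (OU' ∩ BUᶜ ∩ Q) = prob p (OU' ∩ Q) - prob p (OU' ∩ BU ∩ Q) := by linarith
  have key : prob p (BHᶜ ∩ Q) * prob p (OU' ∩ Q) - prob p Q * prob p (OU' ∩ BUᶜ ∩ Q) =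
      prob p Q * prob p (OU' ∩ BU ∩ Q) - prob p (BH ∩ Q) * prob p (OU' ∩ Q) := by
    rw [e1', e2']; ring
  constructor
  · intro h
    linarith [key]
  · intro h
    linarith [key]

end AvoidRow

end RowC1

end Summit.Ventures.PercRepro2
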